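import Summits.QuantumFields.YangMills.Theorems.BalabanUVNodesK0Stub1CorrectedCurrentJunction
import Summits.QuantumFields.YangMills.Theorems.BalabanUVNodesK0Stub1CurlCurlRowOfEq158

/-!
# K0⁷ STUB 1 (`stub_prop8StepCoP13`), sub-target S4a — **p595460's `h128` FROM THE RECORD's CRITICALITY SOCKET AND THE SLICE (153)**: the two operator identities
# displayed by the corrected-current junction (`…K0Stub1CorrectedCurrentJunction`) DISCHARGED at model level for lit-balaban's V1 operators read on matrix fields —
# (hK) the curl–curl letter `(∂*∂)_V A` pairs to zero against every pure gauge (`∂∂ = 0`), (hDK) `⟪δ, Δ_{a,V}A′⟫ = ⟪δ, (∂*∂)_VA′⟫` for `δ ∈ ker Q_V` on the slice `R∂*A′ = 0`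
# ([B6] (2.19), print p. 297 «we can replace Δ by Δ_a») — so that `h128` follows from the SOCKET `h127rec` (record kernel, curl–curl letter), the slice, and nothing else

Cell `pub-ymgap`, width seat `pub-ymgap-k0-s1-w1` g5 (CLAIM-2 sequel; HANDOFF § g4 (t1)(ii); dag-n07-e g20 K0-ROAD-CHAIN-CHECKLIST §6 «CORRECTED CURRENT ○ k0-s1-w1∕w2 next file → h128»).
`--kind proof --supports stmt-QuantumFields-20541 --as helper`; count-neutral.  [15] = [Balaban1985Variational]; [B6] = [Balaban1984PropagatorsII].

WHAT IS PROVED (sorry-free; no definition; axioms standard; `M = M_N(ℂ)`; `⟪X, Y⟫ := Σ_b Re tr(X_bᴴ Y_b)`; kernel-formula extensions as in p595460: `T_VA(k) = Σ_j ((Te_j)(k) : ℂ)·A_j`).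
* §1 `pairing_eq_sum_entries` — `Σ_b Re tr(δ_bᴴ Y_b) = Σ_{ji} (⟪Re δ^{ji}, Re Y^{ji}⟫_{ℓ²} + ⟪Im δ^{ji}, Im Y^{ji}⟫_{ℓ²})` (entrywise real readings); `exists_entryCLM`, `toLp_re_grad`,
  `dcE_dE_one`.
* §2 ★★ `pairing_grad_curlCurlExt_eq_zero` — (hK): `⟪∂μ, (∂*∂)_VA⟫ = 0` for EVERY gauge function `μ` and field `A` (`curl ∘ grad = 0`, `LatticeFieldCalculus.curl_grad`, through
  p608822's `toLp_re_reading_extension`).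
* §3 ★★ `pairing_deltaAEExt_eq_pairing_curlCurlExt` — (hDK): `Q_Vδ = 0` and the slice `R∂*(Re φ∘A′) = 0` for every reading `φ` ⇒ `⟪δ, Δ_{a,V}A′⟫ = ⟪δ, (∂*∂)_VA′⟫`
  (`inner_deltaAE_right`: the `∂R∂*` square dies on the slice, the `Q*aQ` square on `ker Q_V`).
* §4 ★★★ `exists_correctedCurrent_of_slice` — THE JUNCTION WITH ONLY THE SOCKET DISPLAYED: for every nested `D` with the collar property: `T`, `Rᵀ` as in
  `…CorrectedCurrentJunction.exists_correctedCurrent`, and for p595460's letters `DV` (Δ_a), `QV`, the curl–curl extension `KV`, every skew `A′` ON THE SLICE and every current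
  `Wf`: the socket `h127rec` (`⟪δ, K_VA′ + Wf⟫ = 0` on the record's skew multi-level kernel) ⟹ `h128` VERBATIM for `W′ = Wf + RᵀWf`; ★★ `exists_correctedCurrent_of_slice_lieSU`
  (𝔰𝔲(N) tests on both sides).
HONEST SCOPE.  Finite-dimensional bookkeeping over lit-balaban's V1 identities and files B∕C by name; NO estimate (no letter for `Rᵀ`); the socket `h127rec` — the record's
criticality in chart coordinates with the curl–curl Hessian letter — is S2∕S4b's product and stays DISPLAYED; nothing of Bałaban's analysis asserted; `stub_prop8StepCoP13` ∕ K0⁷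
NOT closed; N07 NOT discharged; counts unmoved (28∕28 · 5∕27); one finite 𝕋⁴ programme at fixed ε — R4 closes the conditional finite-𝕋⁴ rung `BalabanLadder.UV` only, never the
summit; the YM mass gap (Clay) is NOT proved by any of this; nothing continuum ∕ ℝ⁴ ∕ OS.  No `sorry`, no `def`, no `instance`, no `notation`.

References: [15] (127)–(128) p.297, (153) p.301, (158) p.302; [B6] (2.5)–(2.8) p.224, (2.19)–(2.20) p.226; [Balaban1984PropagatorsI] (1.2)–(1.4) p.18.
-/

set_option autoImplicit false
noncomputable section
open scoped BigOperators Matrix Matrix.Norms.L2Operator InnerProductSpace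

namespace Summit.QuantumFields.YangMills.Theorems.K0Stub1H128OfRecordCriticality

open Literature.MathematicalPhysics.QuantumFieldTheory.Balaban1983to89
open Literature.MathematicalPhysics.QuantumFieldTheory.BalabanImbrieJaffe1984to88.BIJ85AxialPropagator411 (BondSpace)
open LatticeFieldCalculus (bondAvgIter grad curl)
open B6SectADomainsV1 (Domains)
open B6SectAOperatorsV1 (BondIdx QE QsE RE aE dE dsE dcE dcsE inner_eq_sum inner_dcsE_left)
open B6SectAVectorModelV1 (deltaAE inner_deltaAE_right)
open Node00 (dIterL)
open T4AdjointCovarianceUnitary (lieSU mem_lieSU_iff)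
open Summit.QuantumFields.YangMills.Theorems.K0Stub1CurlCurlRowOfEq158 (toLp_re_reading_extension)
open Summit.QuantumFields.YangMills.Theorems.K0Stub1CorrectedCurrentJunction (exists_correctedCurrent exists_correctedCurrent_lieSU)

variable {P : Params} {N : ℕ}

/-! ## §1  The Frobenius pairing through entrywise real readings -/

/-- **`Σ_b Re tr(δ_bᴴ Y_b) = Σ_{ji} (⟪Re δ^{ji}, Re Y^{ji}⟫ + ⟪Im δ^{ji}, Im Y^{ji}⟫)`** — the Frobenius pairing of matrix fields is the sum over the entries of the `ℓ²`
pairings of their real and imaginary parts. [folklore] -/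
theorem pairing_eq_sum_entries {ι : Type*} [Fintype ι] (δ Y : ι → Matrix (Fin N) (Fin N) ℂ) :
    ∑ b, ((δ b)ᴴ * Y b).trace.re =
      ∑ j, ∑ i, (⟪WithLp.toLp 2 (fun b => (δ b j i).re), WithLp.toLp 2 (fun b => (Y b j i).re)⟫_ℝ +
        ⟪WithLp.toLp 2 (fun b => (δ b j i).im), WithLp.toLp 2 (fun b => (Y b j i).im)⟫_ℝ) := by
  have hL : ∀ b, ((δ b)ᴴ * Y b).trace.re = ∑ j, ∑ i, ((δ b j i).re * (Y b j i).re + (δ b j i).im * (Y b j i).im) := by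
    intro b
    simp only [Matrix.trace, Matrix.diag, Matrix.mul_apply, Matrix.conjTranspose_apply, Complex.re_sum]
    rw [Finset.sum_comm]
    refine Finset.sum_congr rfl fun j _ => Finset.sum_congr rfl fun i _ => ?_
    rw [Complex.star_def, Complex.mul_re, Complex.conj_re, Complex.conj_im]
    ring
  simp only [hL, inner_eq_sum, ← Finset.sum_add_distrib]
  rw [Finset.sum_comm]
  refine Finset.sum_congr rfl fun j _ => ?_
  rw [Finset.sum_comm]

/-- The `(j, i)` matrix entry as a continuous `ℂ`-linear reading. [folklore] -/
theorem exists_entryCLM (j i : Fin N) : ∃ φ : Matrix (Fin N) (Fin N) ℂ →L[ℂ] ℂ, ∀ X, φ X = X j i :=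
  ⟨LinearMap.toContinuousLinearMap
      { toFun := fun X => X j i, map_add' := fun _ _ => rfl, map_smul' := fun _ _ => rfl }, fun _ => rfl⟩

/-- `Im z = Re((−I)·z)`: imaginary parts are real readings too. [folklore] -/
private theorem im_eq_re_neg_I_mul (z : ℂ) : z.im = (-Complex.I * z).re := by
  simp [Complex.mul_re]

/-- The real reading of a plain pure gauge `b ↦ μ(b₊) − μ(b₋)` is the lattice gradient (factor `1`) of the reading of `μ`. [cite: Balaban1984PropagatorsI, (1.4) p.18] -/
theorem toLp_re_grad (μ : Site P 0 → Matrix (Fin N) (Fin N) ℂ) (f : Matrix (Fin N) (Fin N) ℂ → ℝ) (hf : ∀ X Y, f (X - Y) = f X - f Y) :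
    WithLp.toLp 2 (fun b : PBond P 0 => f (μ b.tgt - μ b.src)) = dE 1 (WithLp.toLp 2 (fun x => f (μ x))) := by
  ext b
  rw [B6SectAOperatorsV1.dE_apply, grad, one_smul, PiLp.toLp_apply, hf]

/-- `∂(∂λ) = 0` across lattice factors: `dcE c ∘ dE 1 = 0` (`curl ∘ grad = 0`). [cite: Balaban1984PropagatorsI, (1.2)-(1.4) p.18] -/
theorem dcE_dE_one (c : ℝ) (f : EuclideanSpace ℝ (Site P 0)) : dcE c (dE 1 f) = 0 := by
  ext p
  rw [B6SectAOperatorsV1.dcE_apply, B6SectAOperatorsV1.ofLp_dE, LatticeFieldCalculus.curl_grad]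
  rfl

/-! ## §2  (hK): the curl–curl letter pairs to zero against pure gauges -/

/-- ★★ **(hK) DISCHARGED**: for the kernel extension `K_V` of `∂*∂ = dcsE c ∘ dcE c` and EVERY gauge function `μ` and field `A`: `Σ_b Re tr((μ(b₊) − μ(b₋))ᴴ (K_VA)_b) = 0`
(entrywise: `⟪∂f, ∂*∂g⟫ = ⟪∂∂f, ∂g⟫ = 0`). [cite: Balaban1984PropagatorsII, (2.5) p.224, (2.19) p.226; Balaban1984PropagatorsI, (1.2)-(1.4) p.18] -/
theorem pairing_grad_curlCurlExt_eq_zero {instDE : DecidableEq (PBond P 0)} (c : ℝ)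
    {KV : (PBond P 0 → Matrix (Fin N) (Fin N) ℂ) →ₗ[ℂ] (PBond P 0 → Matrix (Fin N) (Fin N) ℂ)}
    (hKV : ∀ (A : PBond P 0 → Matrix (Fin N) (Fin N) ℂ) (b : PBond P 0),
      KV A b = ∑ j, ((WithLp.ofLp ((dcsE c ∘ₗ dcE c) (WithLp.toLp 2 (Pi.single j 1))) b : ℝ) : ℂ) • A j)
    (μ : Site P 0 → Matrix (Fin N) (Fin N) ℂ) (A : PBond P 0 → Matrix (Fin N) (Fin N) ℂ) :
    ∑ b, ((μ b.tgt - μ b.src)ᴴ * KV A b).trace.re = 0 := by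
  rw [pairing_eq_sum_entries]
  refine Finset.sum_eq_zero fun j _ => Finset.sum_eq_zero fun i _ => ?_
  obtain ⟨φ, hφ⟩ := exists_entryCLM (N := N) j i
  have hψ : ∀ X : Matrix (Fin N) (Fin N) ℂ, ((-Complex.I) • φ) X = -Complex.I * X j i := fun X => by
    show -Complex.I • φ X = _; rw [hφ, smul_eq_mul]
  -- real and imaginary parts of the curl–curl letter
  have hre : WithLp.toLp 2 (fun b => (KV A b j i).re) = (dcsE c ∘ₗ dcE c) (WithLp.toLp 2 (fun b => (A b j i).re)) := by
    simpa only [hφ] using toLp_re_reading_extension (dcsE c ∘ₗ dcE c) (A := A) (𝔄 := KV A) (fun b => hKV A b) φ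
  have him : WithLp.toLp 2 (fun b => (KV A b j i).im) = (dcsE c ∘ₗ dcE c) (WithLp.toLp 2 (fun b => (A b j i).im)) := by
    simpa only [hψ, ← im_eq_re_neg_I_mul] using toLp_re_reading_extension (dcsE c ∘ₗ dcE c) (A := A) (𝔄 := KV A) (fun b => hKV A b) ((-Complex.I) • φ)
  have hgre : WithLp.toLp 2 (fun b : PBond P 0 => ((μ b.tgt - μ b.src) j i).re) = dE 1 (WithLp.toLp 2 (fun x => (μ x j i).re)) :=
    toLp_re_grad μ (fun X => (X j i).re) fun X Y => by rw [Matrix.sub_apply, Complex.sub_re]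
  have hgim : WithLp.toLp 2 (fun b : PBond P 0 => ((μ b.tgt - μ b.src) j i).im) = dE 1 (WithLp.toLp 2 (fun x => (μ x j i).im)) :=
    toLp_re_grad μ (fun X => (X j i).im) fun X Y => by rw [Matrix.sub_apply, Complex.sub_im]
  rw [hre, him, hgre, hgim, LinearMap.comp_apply, LinearMap.comp_apply, real_inner_comm, inner_dcsE_left, dcE_dE_one, inner_zero_right,
    real_inner_comm, inner_dcsE_left, dcE_dE_one, inner_zero_right, add_zero]

/-! ## §3  (hDK): `Δ_a = ∂*∂` in the pairing against `ker Q_V`, on the slice -/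

section Slice

variable (D : Domains P)

/-- ★★ **(hDK) DISCHARGED** ([15] p.297 «we can replace Δ by Δ_a»): for p595460's kernel-formula extensions `Δ_{a,V}` of `deltaAE D c w` and `Q_V` of `QE D`, the curl–curl extension
`K_V`, a field `A′` ON THE SLICE (`R∂*(Re φ ∘ A′) = 0` for every reading `φ`, n07-w3's (153) shape) and a test `δ` with `Q_Vδ = 0`: `⟪δ, Δ_{a,V}A′⟫ = ⟪δ, K_VA′⟫` — by [B6] (2.19)
`⟨x, Δ_ay⟩ = ⟨∂x, ∂y⟩ + ⟨∂*x, R∂*y⟩ + ⟨Qx, aQy⟩` entrywise, the second square dies on the slice and the third on `ker Q_V`.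
[cite: Balaban1985Variational, (127)-(128) p.297, (153) p.301; Balaban1984PropagatorsII, (2.19)-(2.20) p.226] -/
theorem pairing_deltaAEExt_eq_pairing_curlCurlExt {instDE : DecidableEq (PBond P 0)} (c : ℝ) (w : BondIdx D → ℝ)
    {DV KV : (PBond P 0 → Matrix (Fin N) (Fin N) ℂ) →ₗ[ℂ] (PBond P 0 → Matrix (Fin N) (Fin N) ℂ)}
    {QV : (PBond P 0 → Matrix (Fin N) (Fin N) ℂ) →ₗ[ℂ] (BondIdx D → Matrix (Fin N) (Fin N) ℂ)}
    (hDV : ∀ (A : PBond P 0 → Matrix (Fin N) (Fin N) ℂ) (b : PBond P 0),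
      DV A b = ∑ j, ((WithLp.ofLp (deltaAE D c w (WithLp.toLp 2 (Pi.single j 1))) b : ℝ) : ℂ) • A j)
    (hKV : ∀ (A : PBond P 0 → Matrix (Fin N) (Fin N) ℂ) (b : PBond P 0),
      KV A b = ∑ j, ((WithLp.ofLp ((dcsE c ∘ₗ dcE c) (WithLp.toLp 2 (Pi.single j 1))) b : ℝ) : ℂ) • A j)
    (hQV : ∀ (A : PBond P 0 → Matrix (Fin N) (Fin N) ℂ) (t : BondIdx D),
      QV A t = ∑ j, ((WithLp.ofLp (QE D (WithLp.toLp 2 (Pi.single j 1))) t : ℝ) : ℂ) • A j)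
    {A' : PBond P 0 → Matrix (Fin N) (Fin N) ℂ} (hslice : ∀ φ : Matrix (Fin N) (Fin N) ℂ →L[ℂ] ℂ, RE D c (dsE c (WithLp.toLp 2 (fun b => (φ (A' b)).re))) = 0)
    {δ : PBond P 0 → Matrix (Fin N) (Fin N) ℂ} (hQ : QV δ = 0) :
    ∑ b, ((δ b)ᴴ * DV A' b).trace.re = ∑ b, ((δ b)ᴴ * KV A' b).trace.re := by
  rw [pairing_eq_sum_entries, pairing_eq_sum_entries]
  refine Finset.sum_congr rfl fun j _ => Finset.sum_congr rfl fun i _ => ?_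
  obtain ⟨φ, hφ⟩ := exists_entryCLM (N := N) j i
  have hψ : ∀ X : Matrix (Fin N) (Fin N) ℂ, ((-Complex.I) • φ) X = -Complex.I * X j i := fun X => by
    show -Complex.I • φ X = _; rw [hφ, smul_eq_mul]
  -- the readings of the three extensions
  have hDre : WithLp.toLp 2 (fun b => (DV A' b j i).re) = deltaAE D c w (WithLp.toLp 2 (fun b => (A' b j i).re)) := by
    simpa only [hφ] using toLp_re_reading_extension (deltaAE D c w) (A := A') (𝔄 := DV A') (fun b => hDV A' b) φ
  have hDim : WithLp.toLp 2 (fun b => (DV A' b j i).im) = deltaAE D c w (WithLp.toLp 2 (fun b => (A' b j i).im)) := by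
    simpa only [hψ, ← im_eq_re_neg_I_mul] using toLp_re_reading_extension (deltaAE D c w) (A := A') (𝔄 := DV A') (fun b => hDV A' b) ((-Complex.I) • φ)
  have hKre : WithLp.toLp 2 (fun b => (KV A' b j i).re) = (dcsE c ∘ₗ dcE c) (WithLp.toLp 2 (fun b => (A' b j i).re)) := by
    simpa only [hφ] using toLp_re_reading_extension (dcsE c ∘ₗ dcE c) (A := A') (𝔄 := KV A') (fun b => hKV A' b) φ
  have hKim : WithLp.toLp 2 (fun b => (KV A' b j i).im) = (dcsE c ∘ₗ dcE c) (WithLp.toLp 2 (fun b => (A' b j i).im)) := by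
    simpa only [hψ, ← im_eq_re_neg_I_mul] using toLp_re_reading_extension (dcsE c ∘ₗ dcE c) (A := A') (𝔄 := KV A') (fun b => hKV A' b) ((-Complex.I) • φ)
  -- the test's readings lie in `ker Q`
  have hQre : QE D (WithLp.toLp 2 (fun b => (δ b j i).re)) = 0 := by
    have h := toLp_re_reading_extension (QE D) (A := δ) (𝔄 := QV δ) (fun t => hQV δ t) φ
    simp only [hφ, hQ, Pi.zero_apply, Matrix.zero_apply, Complex.zero_re] at h
    rw [← h]
    rfl
  have hQim : QE D (WithLp.toLp 2 (fun b => (δ b j i).im)) = 0 := by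
    have h := toLp_re_reading_extension (QE D) (A := δ) (𝔄 := QV δ) (fun t => hQV δ t) ((-Complex.I) • φ)
    simp only [hψ, ← im_eq_re_neg_I_mul, hQ, Pi.zero_apply, Matrix.zero_apply, Complex.zero_im] at h
    rw [← h]
    rfl
  -- the field's readings are on the slice
  have hSre : RE D c (dsE c (WithLp.toLp 2 (fun b => (A' b j i).re))) = 0 := by simpa only [hφ] using hslice φ
  have hSim : RE D c (dsE c (WithLp.toLp 2 (fun b => (A' b j i).im))) = 0 := by
    simpa only [hψ, ← im_eq_re_neg_I_mul] using hslice ((-Complex.I) • φ)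
  -- `⟪x, ∂*∂y⟫ = ⟪∂x, ∂y⟫`
  have key : ∀ x y : BondSpace P, ⟪x, (dcsE c ∘ₗ dcE c) y⟫_ℝ = ⟪dcE c x, dcE c y⟫_ℝ := fun x y => by
    rw [LinearMap.comp_apply, ← real_inner_comm x (dcsE c (dcE c y)), inner_dcsE_left, real_inner_comm (dcE c x) (dcE c y)]
  rw [hDre, hDim, hKre, hKim, inner_deltaAE_right, inner_deltaAE_right, hQre, hQim, hSre, hSim, key, key]
  simp only [inner_zero_right, inner_zero_left, add_zero]

end Slice

/-! ## §4  The junction with only the socket displayed -/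

section Junction

variable [NeZero N] (D : Domains P)
  (hcollar : ∀ (i : ℕ) (e : PBond P (i + 1)), D.LamBond (i + 1) e → ∀ z : Site P i, (blockOf z = e.src ∨ blockOf z = e.tgt) → z ∈ D.Om i)

include hcollar in
/-- ★★★ **p595460's `h128` FROM THE RECORD's CRITICALITY SOCKET + THE SLICE.**  For every nested `D` with the collar property: `T` (p617458's gauge map) and the
skew-valued ℝ-linear `Rᵀ` (`⟪δ, RᵀW⟫ = ⟪∂(Tδ), W⟫` on skew tests) of `…CorrectedCurrentJunction.exists_correctedCurrent`, such that for p595460's kernel-formula letters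
`DV` (`Δ_a = deltaAE D c w`), `QV` (`QE D`) and the curl–curl extension `KV` (`dcsE c ∘ dcE c`), every field `A′` ON THE SLICE (153) (`RE D c (dsE c (Re φ ∘ A′)) = 0` for every
reading `φ`) and every current `Wf`: the SOCKET `h127rec` — `Σ_j Re tr(δ_jᴴ((K_VA′)_j + Wf_j)) = 0` for every skew `δ` with `Q_j(1)δ = 0` on every `Λ_j`-bond (the record's
criticality in chart coordinates) — IMPLIES `h128` VERBATIM for the corrected current: `∀ δ skew, QVδ = 0 → Σ_j Re tr(δ_jᴴ((DV A′)_j + (Wf_j + (RᵀWf)_j))) = 0`.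
[cite: Balaban1985Variational, (127)-(128) p.297, (153) p.301, (158) p.302; Balaban1984PropagatorsII, (2.19)-(2.20) p.226, (2.6)-(2.7) p.224] -/
theorem exists_correctedCurrent_of_slice :
    ∃ (T : (PBond P 0 → Matrix (Fin N) (Fin N) ℂ) →ₗ[ℂ] (Site P 0 → Matrix (Fin N) (Fin N) ℂ))
      (Rt : (PBond P 0 → Matrix (Fin N) (Fin N) ℂ) →ₗ[ℝ] (PBond P 0 → Matrix (Fin N) (Fin N) ℂ)),
      (∀ Z : PBond P 0 → Matrix (Fin N) (Fin N) ℂ, (∀ b, (Z b)ᴴ = -Z b) → ∀ x, (T Z x)ᴴ = -T Z x) ∧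
      (∀ (Z : PBond P 0 → Matrix (Fin N) (Fin N) ℂ) (s : ℝ), 0 ≤ s → (∀ b, ‖Z b‖ ≤ s) →
        ∀ x, ‖T Z x‖ ≤ ((P.d + 2 : ℕ) : ℝ) * (P.L : ℝ) ^ (D.k + 1) * s) ∧
      (∀ W b, (Rt W b)ᴴ = -(Rt W b)) ∧
      (∀ δ W : PBond P 0 → Matrix (Fin N) (Fin N) ℂ, (∀ b, (δ b)ᴴ = -δ b) →
        ∑ b, ((δ b)ᴴ * Rt W b).trace.re = ∑ b, ((T δ b.tgt - T δ b.src)ᴴ * W b).trace.re) ∧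
      ∀ {instDE : DecidableEq (PBond P 0)} {DV KV : (PBond P 0 → Matrix (Fin N) (Fin N) ℂ) →ₗ[ℂ] (PBond P 0 → Matrix (Fin N) (Fin N) ℂ)}
        {QV : (PBond P 0 → Matrix (Fin N) (Fin N) ℂ) →ₗ[ℂ] (BondIdx D → Matrix (Fin N) (Fin N) ℂ)} (c : ℝ) (w : BondIdx D → ℝ),
        (∀ (A : PBond P 0 → Matrix (Fin N) (Fin N) ℂ) (b : PBond P 0),
          DV A b = ∑ j, ((WithLp.ofLp (deltaAE D c w (WithLp.toLp 2 (Pi.single j 1))) b : ℝ) : ℂ) • A j) →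
        (∀ (A : PBond P 0 → Matrix (Fin N) (Fin N) ℂ) (b : PBond P 0),
          KV A b = ∑ j, ((WithLp.ofLp ((dcsE c ∘ₗ dcE c) (WithLp.toLp 2 (Pi.single j 1))) b : ℝ) : ℂ) • A j) →
        (∀ (A : PBond P 0 → Matrix (Fin N) (Fin N) ℂ) (t : BondIdx D),
          QV A t = ∑ j, ((WithLp.ofLp (QE D (WithLp.toLp 2 (Pi.single j 1))) t : ℝ) : ℂ) • A j) →
        ∀ (A' Wf : PBond P 0 → Matrix (Fin N) (Fin N) ℂ),
          (∀ φ : Matrix (Fin N) (Fin N) ℂ →L[ℂ] ℂ, RE D c (dsE c (WithLp.toLp 2 (fun b => (φ (A' b)).re))) = 0) →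
          (∀ δ : PBond P 0 → Matrix (Fin N) (Fin N) ℂ, (∀ b, (δ b)ᴴ = -δ b) →
            (∀ (j : ℕ) (e : PBond P j), D.LamBond j e → dIterL j (1 : PBond P 0 → Matrix (Fin N) (Fin N) ℂ) δ e = 0) →
            ∑ b, ((δ b)ᴴ * (KV A' b + Wf b)).trace.re = 0) →
          ∀ δ : PBond P 0 → Matrix (Fin N) (Fin N) ℂ, (∀ b, (δ b)ᴴ = -δ b) → QV δ = 0 →
            ∑ b, ((δ b)ᴴ * (DV A' b + (Wf b + Rt Wf b))).trace.re = 0 := by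
  obtain ⟨T, Rt, h1, h2, h3, h4, hj⟩ := exists_correctedCurrent (N := N) D hcollar
  refine ⟨T, Rt, h1, h2, h3, h4, ?_⟩
  intro instDE DV KV QV c w hDV hKV hQV A' Wf hslice h127 δ hδ hQ
  exact hj hQV (DV A') (KV A') Wf (fun μ _ => pairing_grad_curlCurlExt_eq_zero c hKV μ A')
    (fun δ' _ hQ' => pairing_deltaAEExt_eq_pairing_curlCurlExt D c w hDV hKV hQV hslice hQ') h127 δ hδ hQ

include hcollar in
/-- ★★ **THE SAME WITH 𝔰𝔲(N)-VALUED TESTS ON BOTH SIDES** (p604735's `h128` letter; the socket's tests are the 𝔰𝔲(N)-valued fields of the record's multi-level kernel,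
dag-n07-w1's `qLin j 1` = `dIterL j 1 ↑·`). [cite: Balaban1985Variational, (127)-(128) p.297, (3)-(4) p.278, (153) p.301; Balaban1984PropagatorsII, (2.19)-(2.20) p.226] -/
theorem exists_correctedCurrent_of_slice_lieSU :
    ∃ (T : (PBond P 0 → Matrix (Fin N) (Fin N) ℂ) →ₗ[ℂ] (Site P 0 → Matrix (Fin N) (Fin N) ℂ))
      (Rt : (PBond P 0 → Matrix (Fin N) (Fin N) ℂ) →ₗ[ℝ] (PBond P 0 → Matrix (Fin N) (Fin N) ℂ)),
      (∀ Z : PBond P 0 → Matrix (Fin N) (Fin N) ℂ, (∀ b, Z b ∈ lieSU (Fin N)) → ∀ x, T Z x ∈ lieSU (Fin N)) ∧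
      (∀ (Z : PBond P 0 → Matrix (Fin N) (Fin N) ℂ) (s : ℝ), 0 ≤ s → (∀ b, ‖Z b‖ ≤ s) →
        ∀ x, ‖T Z x‖ ≤ ((P.d + 2 : ℕ) : ℝ) * (P.L : ℝ) ^ (D.k + 1) * s) ∧
      (∀ W b, (Rt W b)ᴴ = -(Rt W b)) ∧
      (∀ δ W : PBond P 0 → Matrix (Fin N) (Fin N) ℂ, (∀ b, (δ b)ᴴ = -δ b) →
        ∑ b, ((δ b)ᴴ * Rt W b).trace.re = ∑ b, ((T δ b.tgt - T δ b.src)ᴴ * W b).trace.re) ∧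
      ∀ {instDE : DecidableEq (PBond P 0)} {DV KV : (PBond P 0 → Matrix (Fin N) (Fin N) ℂ) →ₗ[ℂ] (PBond P 0 → Matrix (Fin N) (Fin N) ℂ)}
        {QV : (PBond P 0 → Matrix (Fin N) (Fin N) ℂ) →ₗ[ℂ] (BondIdx D → Matrix (Fin N) (Fin N) ℂ)} (c : ℝ) (w : BondIdx D → ℝ),
        (∀ (A : PBond P 0 → Matrix (Fin N) (Fin N) ℂ) (b : PBond P 0),
          DV A b = ∑ j, ((WithLp.ofLp (deltaAE D c w (WithLp.toLp 2 (Pi.single j 1))) b : ℝ) : ℂ) • A j) →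
        (∀ (A : PBond P 0 → Matrix (Fin N) (Fin N) ℂ) (b : PBond P 0),
          KV A b = ∑ j, ((WithLp.ofLp ((dcsE c ∘ₗ dcE c) (WithLp.toLp 2 (Pi.single j 1))) b : ℝ) : ℂ) • A j) →
        (∀ (A : PBond P 0 → Matrix (Fin N) (Fin N) ℂ) (t : BondIdx D),
          QV A t = ∑ j, ((WithLp.ofLp (QE D (WithLp.toLp 2 (Pi.single j 1))) t : ℝ) : ℂ) • A j) →
        ∀ (A' Wf : PBond P 0 → Matrix (Fin N) (Fin N) ℂ),
          (∀ φ : Matrix (Fin N) (Fin N) ℂ →L[ℂ] ℂ, RE D c (dsE c (WithLp.toLp 2 (fun b => (φ (A' b)).re))) = 0) →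
          (∀ δ : PBond P 0 → lieSU (Fin N),
            (∀ (j : ℕ) (e : PBond P j), D.LamBond j e →
              dIterL j (1 : PBond P 0 → Matrix (Fin N) (Fin N) ℂ) (fun b => (δ b : Matrix (Fin N) (Fin N) ℂ)) e = 0) →
            ∑ b, (((δ b : Matrix (Fin N) (Fin N) ℂ))ᴴ * (KV A' b + Wf b)).trace.re = 0) →
          ∀ δ : PBond P 0 → lieSU (Fin N), QV (fun b => (δ b : Matrix (Fin N) (Fin N) ℂ)) = 0 →
            ∑ b, (((δ b : Matrix (Fin N) (Fin N) ℂ))ᴴ * (DV A' b + (Wf b + Rt Wf b))).trace.re = 0 := by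
  obtain ⟨T, Rt, h1, h2, h3, h4, hj⟩ := exists_correctedCurrent_lieSU (N := N) D hcollar
  refine ⟨T, Rt, h1, h2, h3, h4, ?_⟩
  intro instDE DV KV QV c w hDV hKV hQV A' Wf hslice h127 δ hQ
  exact hj hQV (DV A') (KV A') Wf (fun μ => pairing_grad_curlCurlExt_eq_zero c hKV (fun x => (μ x : Matrix (Fin N) (Fin N) ℂ)) A')
    (fun δ' hQ' => pairing_deltaAEExt_eq_pairing_curlCurlExt D c w hDV hKV hQV hslice hQ') h127 δ hQ

end Junction

end Summit.QuantumFields.YangMills.Theorems.K0Stub1H128OfRecordCriticality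

end
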